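import Mathlib.RingTheory.AdjoinRoot
import Mathlib.LinearAlgebra.Matrix.Block
import Mathlib.LinearAlgebra.Matrix.Polynomial
import Mathlib.LinearAlgebra.Vandermonde
import Mathlib.RingTheory.Polynomial.Basic
import HarnessLib

/-!
# The kernel polynomial of a distinguished subgroup by norms (Blakestad–Grant 2023, Prop. 7 (a)
# and (4))

Trunk T-NT-EC (Literature/NumberTheory/EllipticCurves). Blakestad–Grant (J. Number Theory 249
(2023), Prop. 7 and its displayed equation (4)) need, for the canonical subgroup `G` of the
universal ordinary curve `𝓔/R̂`, that `φ_ψ(x) = p·∏'(x - x(u)) = p·D(x)` has coefficients in `R̂`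
and `φ_ψ ≡ ℓ̃₀ (mod p)` with `ℓ̃₀ ∈ R̂ˣ` — (4) — equivalently (proof of Prop. 7 (a)) that "every
elementary symmetric function in the roots of `φ_ψ(x)` lies in `R̂` except for the product of the
roots, which lies in `p⁻¹R̂`". They get (4) by `p`-adic Weierstrass preparation applied to the
division polynomial `φ_p(x)`. This file gives an ALTERNATIVE, points-free derivation of the same
shape of statement from a distinguished polynomial `g` (our gloss: `g = e⁺`, the even Weierstrass
factor of `[p]` in `q = t²`, whose roots are the `t(u)²`, `u ∈ G - O`, and `w = z²x` reduced
modulo `e⁺`, so that `x(u) = w(q)/q` at `q = t(u)²`), by a determinant argument over an arbitrary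
commutative ring `A`:

* `mulMatrix hg b` — the matrix of multiplication by `b` on `A[q]/(g)` (`g` monic of degree `n`) in
  the power basis; `normForm hg w = Φ_w(X) = det(X·M_{q̄} - M_{w̄}) ∈ A[X]`
  (`= N_{(A[q]/(g))[X]/A[X]}(Xq̄ - w̄)`).
* `normForm_map_mk` — if `g ≡ qⁿ (mod I)` then modulo `I` the matrix `X·M_{q̄} - M_{w̄}` is LOWER
  TRIANGULAR with diagonal `-w(0)` (`M_{q̄} ≡` shift, `M_{w̄} ≡ ∑ wₘ·shiftᵐ`), so
  **`Φ_w ≡ (-w(0))ⁿ (mod I)`**: a constant.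
* `normForm_map_eq_prod` — over a field `F ⊇ A` containing `n = deg g` distinct roots `qⱼ` of `g`,
  **`Φ_w = ∏ⱼ (qⱼX - w(qⱼ))`**: the rows `(qⱼⁱ)ᵢ` of the Vandermonde matrix are common
  eigen-covectors of all `M_b` (`(qⱼⁱ)ᵢ·M_b = σⱼ(b)(qⱼⁱ)ᵢ`, `σⱼ = ` evaluation at `qⱼ`), so
  `V·(X·M_{q̄} - M_{w̄}) = diag(qⱼX - w(qⱼ))·V` with `det V ≠ 0`.
* **`kernelPolynomial_of_distinguished`** — for `g` distinguished (`g ≡ qⁿ (mod p)`, `g(0) = pc`,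
  `c ∈ Aˣ`) and `φ := (-1)ⁿc⁻¹Φ_w`: `φ = p·∏ⱼ(X - w(qⱼ)/qⱼ)` over `F`, `deg φ ≤ n`, `[Xⁿ]φ = p`,
  `p ∣ [Xᵏ]φ (k ≥ 1)`, `[X⁰]φ ≡ c⁻¹w(0)ⁿ (mod p)` — the shape of (4), with "all elementary
  symmetric functions of the `w(qⱼ)/qⱼ` in `A` except the product, in `p⁻¹A`".

## Sources

* C. Blakestad, D. Grant, *On the universal `p`-adic sigma and Weierstrass zeta functions*,
  J. Number Theory 249 (2023) 348–376 (arXiv:1903.02480), Prop. 7 (a) and its proof, eq. (4).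
  [BlakestadGrant2023]
* N. Katz, *p-adic properties of modular schemes and modular forms* (1973), Ch. 3 (canonical
  subgroup); J. Lubin, Ann. of Math. 85 (1967) (finite subgroups of formal groups as Weierstrass
  polynomials). [folklore]

No named facts; two definitions (`mulMatrix`, `normForm`).
-/

noncomputable section

open Polynomial Matrix

namespace Literature.NumberTheory.EllipticCurves.CanonicalSubgroupNorm

variable {A : Type*} [CommRing A] {g : A[X]}

/-- The matrix of multiplication by `b` on `A[q]/(g)` in the power basis `1, q̄, …, q̄ⁿ⁻¹`
(`g` monic of degree `n`). [folklore] -/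
def mulMatrix (hg : g.Monic) (b : AdjoinRoot g) : Matrix (Fin g.natDegree) (Fin g.natDegree) A :=
  Algebra.leftMulMatrix (AdjoinRoot.powerBasis' hg).basis b

/-- **The norm form** `Φ_w(X) = det(X·M_{q̄} - M_{w̄}) = N_{A[q]/(g) ⊗ A[X] / A[X]}(X q̄ - w̄) ∈ A[X]`.
[Blakestad–Grant 2023, proof of Prop. 7 (a) (symmetric functions of the kernel)]
[cite: BlakestadGrant2023, Prop. 7] -/
def normForm (hg : g.Monic) (w : A[X]) : A[X] :=
  Matrix.det ((X : A[X]) • (mulMatrix hg (AdjoinRoot.root g)).map C + (-mulMatrix hg (AdjoinRoot.mk g w)).map C)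

/-- Entries of `M_{h̄}`: `(M_{h̄})ᵢⱼ = [Xⁱ]((h·Xʲ) mod g)`. [folklore] -/
theorem mulMatrix_mk_apply (hg : g.Monic) (h : A[X]) (i j : Fin g.natDegree) :
    mulMatrix hg (AdjoinRoot.mk g h) i j = ((h * X ^ (j : ℕ)) %ₘ g).coeff i := by
  rw [mulMatrix, Algebra.leftMulMatrix_eq_repr_mul, PowerBasis.coe_basis]
  have hgen : (AdjoinRoot.powerBasis' hg).gen = AdjoinRoot.root g := rfl
  simp only [hgen]
  rw [show AdjoinRoot.mk g h * AdjoinRoot.root g ^ (j : ℕ) = AdjoinRoot.mk g (h * X ^ (j : ℕ)) by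
    rw [map_mul, map_pow, AdjoinRoot.mk_X]]
  change (AdjoinRoot.powerBasisAux' hg).repr _ i = _
  rw [AdjoinRoot.powerBasisAux'_repr_apply_to_fun, AdjoinRoot.modByMonicHom_mk]

/-- Entries of `M_{q̄}`: `(M_{q̄})ᵢⱼ = [Xⁱ](Xʲ⁺¹ mod g)` (the companion matrix). [folklore] -/
theorem mulMatrix_root_apply (hg : g.Monic) (i j : Fin g.natDegree) :
    mulMatrix hg (AdjoinRoot.root g) i j = ((X ^ ((j : ℕ) + 1)) %ₘ g).coeff i := by
  rw [← AdjoinRoot.mk_X, mulMatrix_mk_apply, pow_succ']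

/-- Low coefficients of a remainder modulo a monic `g ≡ Xⁿ (mod I)`: `[Xⁱ](f mod g) ≡ [Xⁱ]f (mod I)`
for `i < n`. [folklore] -/
theorem coeff_modByMonic_sub_coeff_mem (hg : g.Monic) {I : Ideal A} (hgI : ∀ k < g.natDegree, g.coeff k ∈ I)
    (f : A[X]) {i : ℕ} (hi : i < g.natDegree) : (f %ₘ g).coeff i - f.coeff i ∈ I := by
  rw [← Ideal.Quotient.eq_zero_iff_mem, map_sub, sub_eq_zero, ← Polynomial.coeff_map, ← Polynomial.coeff_map,
    Polynomial.map_modByMonic _ hg]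
  have hgmap : g.map (Ideal.Quotient.mk I) = X ^ g.natDegree := by
    ext k
    rw [Polynomial.coeff_map, coeff_X_pow]
    rcases lt_trichotomy k g.natDegree with hk | rfl | hk
    · rw [if_neg hk.ne, Ideal.Quotient.eq_zero_iff_mem]; exact hgI k hk
    · rw [if_pos rfl, Polynomial.coeff_natDegree, hg.leadingCoeff, map_one]
    · rw [if_neg hk.ne', Polynomial.coeff_eq_zero_of_natDegree_lt hk, map_zero]
  rw [hgmap]
  set F := f.map (Ideal.Quotient.mk I)
  have h := modByMonic_add_div F (X ^ g.natDegree)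
  conv_rhs => rw [← h]
  rw [coeff_add, mul_comm, coeff_mul_X_pow', if_neg (not_le.mpr hi), add_zero]

/-- Entries of `M_{h̄}` modulo `I` when `g ≡ Xⁿ (mod I)`: `(M_{h̄})ᵢⱼ ≡ [X^{i-j}]h` (`0` above the
diagonal). [folklore] -/
theorem mulMatrix_mk_sub_mem (hg : g.Monic) {I : Ideal A} (hgI : ∀ k < g.natDegree, g.coeff k ∈ I) (h : A[X])
    (i j : Fin g.natDegree) :
    mulMatrix hg (AdjoinRoot.mk g h) i j - (if (j : ℕ) ≤ i then h.coeff (i - j) else 0) ∈ I := by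
  rw [mulMatrix_mk_apply]
  have e : (if (j : ℕ) ≤ i then h.coeff (i - j) else 0) = (h * X ^ (j : ℕ)).coeff i := by
    rw [coeff_mul_X_pow']
  rw [e]
  exact coeff_modByMonic_sub_coeff_mem hg hgI _ i.isLt

/-- **`Φ_w ≡ (-w₀)ⁿ (mod I)`** when `g ≡ Xⁿ (mod I)`: modulo `I` the matrix `X·M_{q̄} - M_{w̄}` is lower
triangular with diagonal `-w₀`. So all non-constant coefficients of `Φ_w` lie in `I` and
`Φ_w(0) ≡ (-w(0))ⁿ`. [Blakestad–Grant 2023, eq. (4): "`φ_ψ(x) ≡ ℓ_{p(p-1)/2} ≡ H mod p`"]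
[cite: BlakestadGrant2023, Prop. 7, eq. (4)] -/
theorem normForm_map_mk (hg : g.Monic) {I : Ideal A} (hgI : ∀ k < g.natDegree, g.coeff k ∈ I) (w : A[X]) :
    (normForm hg w).map (Ideal.Quotient.mk I) = C (Ideal.Quotient.mk I ((-w.coeff 0) ^ g.natDegree)) := by
  set mk := Ideal.Quotient.mk I with hmk
  have hdet : (normForm hg w).map mk =
      Matrix.det ((X : (A ⧸ I)[X]) • ((mulMatrix hg (AdjoinRoot.root g)).map mk).map C +
        (-(mulMatrix hg (AdjoinRoot.mk g w)).map mk).map C) := by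
    rw [normForm, ← Polynomial.coe_mapRingHom, RingHom.map_det, RingHom.mapMatrix_apply]
    congr 1
    ext i j
    simp only [Matrix.map_apply, Matrix.add_apply, Matrix.smul_apply, Matrix.neg_apply, smul_eq_mul,
      Polynomial.coe_mapRingHom, Polynomial.map_add, Polynomial.map_mul, Polynomial.map_X, Polynomial.map_C,
      Polynomial.map_neg, map_neg]
  rw [hdet]
  set P := (X : (A ⧸ I)[X]) • ((mulMatrix hg (AdjoinRoot.root g)).map mk).map C +
    (-(mulMatrix hg (AdjoinRoot.mk g w)).map mk).map C with hP
  -- entries modulo `I`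
  have hroot : ∀ i j : Fin g.natDegree, mk (mulMatrix hg (AdjoinRoot.root g) i j) =
      if (i : ℕ) = j + 1 then 1 else 0 := by
    intro i j
    have h := mulMatrix_mk_sub_mem hg hgI X i j
    rw [AdjoinRoot.mk_X] at h
    have e : (if (j : ℕ) ≤ i then (X : A[X]).coeff (i - j) else 0) = (if (i : ℕ) = j + 1 then (1 : A) else 0) := by
      by_cases h2 : (i : ℕ) = j + 1
      · rw [if_pos h2, if_pos (by omega), show (i : ℕ) - j = 1 by omega, coeff_X_one]
      · rw [if_neg h2]
        split_ifs with h3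
        · exact coeff_X_of_ne_one (by omega)
        · rfl
    rw [e] at h
    rw [Ideal.Quotient.eq.mpr h]
    split_ifs <;> simp
  have hw : ∀ i j : Fin g.natDegree, mk (mulMatrix hg (AdjoinRoot.mk g w) i j) =
      if (j : ℕ) ≤ i then mk (w.coeff (i - j)) else 0 := by
    intro i j
    rw [Ideal.Quotient.eq.mpr (mulMatrix_mk_sub_mem hg hgI w i j)]
    split_ifs
    · rfl
    · exact map_zero _
  have hPij : ∀ i j : Fin g.natDegree, P i j =
      X * C (if (i : ℕ) = j + 1 then 1 else 0) - C (if (j : ℕ) ≤ i then mk (w.coeff (i - j)) else 0) := by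
    intro i j
    simp only [hP, Matrix.add_apply, Matrix.smul_apply, Matrix.map_apply, Matrix.neg_apply, smul_eq_mul, hroot, hw,
      map_neg, sub_eq_add_neg]
  have htri : P.BlockTriangular OrderDual.toDual := by
    intro i j hij
    have hlt : (i : ℕ) < j := by
      have : j < i ↔ OrderDual.toDual i < OrderDual.toDual j := Iff.rfl
      exact_mod_cast (OrderDual.toDual_lt_toDual.mp hij)
    rw [hPij, if_neg (by omega), if_neg (by omega)]
    simp
  rw [Matrix.det_of_lowerTriangular P htri]
  have hdiag : ∀ i : Fin g.natDegree, P i i = C (mk (-w.coeff 0)) := by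
    intro i
    rw [hPij, if_neg (by omega), if_pos le_rfl, Nat.sub_self, map_zero, mul_zero, zero_sub, ← map_neg C, ← map_neg mk]
  simp only [hdiag, Finset.prod_const, Finset.card_univ, Fintype.card_fin, ← map_pow]

/-! ### The norm form over a field containing `n` distinct roots of `g` -/

/-- `Φ_w` under a ring map. [folklore] -/
theorem normForm_map (hg : g.Monic) (w : A[X]) {S : Type*} [CommRing S] (φ : A →+* S) :
    (normForm hg w).map φ = Matrix.det ((X : S[X]) • ((mulMatrix hg (AdjoinRoot.root g)).map φ).map C +
      (-(mulMatrix hg (AdjoinRoot.mk g w)).map φ).map C) := by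
  rw [normForm, ← Polynomial.coe_mapRingHom, RingHom.map_det, RingHom.mapMatrix_apply]
  congr 1
  ext i j
  simp only [Matrix.map_apply, Matrix.add_apply, Matrix.smul_apply, Matrix.neg_apply, smul_eq_mul,
    Polynomial.coe_mapRingHom, Polynomial.map_add, Polynomial.map_mul, Polynomial.map_X, Polynomial.map_C,
    Polynomial.map_neg, map_neg]

section Roots

variable {F : Type*} [Field F]

/-- **Eigen-covectors of the multiplication matrices**: for a root `r` of `g` in `F` (over
`f : A → F`) and `σ_r : A[q]/(g) → F` the evaluation at `r`, the row vector `(rⁱ)ᵢ` satisfies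
`(rⁱ)ᵢ · M_b = σ_r(b)·(rⁱ)ᵢ`. [folklore] -/
theorem sum_pow_mul_mulMatrix (hg : g.Monic) (f : A →+* F) {r : F} (hr : g.eval₂ f r = 0) (b : AdjoinRoot g)
    (k : Fin g.natDegree) :
    ∑ i : Fin g.natDegree, r ^ (i : ℕ) * f (mulMatrix hg b i k) = AdjoinRoot.lift f r hr b * r ^ (k : ℕ) := by
  set σ := AdjoinRoot.lift f r hr with hσ
  have hgen : (AdjoinRoot.powerBasis' hg).gen = AdjoinRoot.root g := rfl
  have h1 : ∀ i : Fin g.natDegree, σ ((AdjoinRoot.powerBasis' hg).basis i) = r ^ (i : ℕ) := by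
    intro i
    rw [PowerBasis.coe_basis]
    simp only [hgen, map_pow, hσ, AdjoinRoot.lift_root]
  have h2 := congrArg σ ((AdjoinRoot.powerBasis' hg).basis.sum_repr (b * (AdjoinRoot.powerBasis' hg).basis k))
  rw [map_sum, RingHom.map_mul, h1 k] at h2
  rw [← h2]
  refine Finset.sum_congr rfl fun i _ => ?_
  rw [Algebra.smul_def, RingHom.map_mul, h1 i, AdjoinRoot.algebraMap_eq, hσ, AdjoinRoot.lift_of, mul_comm, mulMatrix,
    Algebra.leftMulMatrix_eq_repr_mul]

/-- **`Φ_w = ∏ⱼ (qⱼX - w(qⱼ))` over a field containing `n = deg g` distinct roots `qⱼ` of `g`**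
(so `p·∏ⱼ(X - w(qⱼ)/qⱼ) = ±c⁻¹Φ_w` when `g(0) = ±p·c·∏…`): the Vandermonde matrix of the `qⱼ`
conjugates `X·M_{q̄} - M_{w̄}` into `diag(qⱼX - w(qⱼ))`. [Blakestad–Grant 2023, proof of Prop. 7 (a)]
[cite: BlakestadGrant2023, Prop. 7] -/
theorem normForm_map_eq_prod (hg : g.Monic) (f : A →+* F) {q : Fin g.natDegree → F} (hq : Function.Injective q)
    (hroot : ∀ j, g.eval₂ f (q j) = 0) (w : A[X]) :
    (normForm hg w).map f = ∏ j, (C (q j) * X - C (w.eval₂ f (q j))) := by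
  set Mr := (mulMatrix hg (AdjoinRoot.root g)).map f with hMr
  set Mw := (mulMatrix hg (AdjoinRoot.mk g w)).map f with hMw
  set P : Matrix (Fin g.natDegree) (Fin g.natDegree) F[X] := (X : F[X]) • Mr.map C + (-Mw).map C with hP
  have hdet : (normForm hg w).map f = P.det := by rw [hP, hMr, hMw]; exact normForm_map hg w f
  set V : Matrix (Fin g.natDegree) (Fin g.natDegree) F[X] := (Matrix.vandermonde q).map C with hV
  set d : Fin g.natDegree → F[X] := fun j => C (q j) * X - C (w.eval₂ f (q j)) with hd
  -- `V·P = diag(d)·V`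
  have hσr : ∀ j, AdjoinRoot.lift f (q j) (hroot j) (AdjoinRoot.root g) = q j := fun j => AdjoinRoot.lift_root _
  have hσw : ∀ j, AdjoinRoot.lift f (q j) (hroot j) (AdjoinRoot.mk g w) = w.eval₂ f (q j) := fun j =>
    AdjoinRoot.lift_mk _ _
  have hVP : V * P = Matrix.diagonal d * V := by
    ext j k
    rw [Matrix.mul_apply, Matrix.diagonal_mul]
    have hr := sum_pow_mul_mulMatrix hg f (hroot j) (AdjoinRoot.root g) k
    have hw := sum_pow_mul_mulMatrix hg f (hroot j) (AdjoinRoot.mk g w) k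
    rw [hσr] at hr
    rw [hσw] at hw
    have e : ∀ i, V j i * P i k = X * C (q j ^ (i : ℕ) * f (mulMatrix hg (AdjoinRoot.root g) i k)) -
        C (q j ^ (i : ℕ) * f (mulMatrix hg (AdjoinRoot.mk g w) i k)) := by
      intro i
      simp only [hV, hP, hMr, hMw, Matrix.map_apply, Matrix.vandermonde_apply, Matrix.add_apply, Matrix.smul_apply,
        Matrix.neg_apply, smul_eq_mul, map_mul, map_neg]
      ring
    simp only [e, Finset.sum_sub_distrib, ← Finset.mul_sum, ← map_sum, hr, hw]
    simp only [hV, hd, Matrix.map_apply, Matrix.vandermonde_apply, map_mul, map_pow]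
    ring
  -- determinants
  have hdetV : V.det ≠ 0 := by
    rw [hV, ← RingHom.mapMatrix_apply, ← RingHom.map_det]
    exact (map_ne_zero_iff _ (Polynomial.C_injective)).mpr (Matrix.det_vandermonde_ne_zero_iff.mpr hq)
  have h := congrArg Matrix.det hVP
  rw [Matrix.det_mul, Matrix.det_mul, Matrix.det_diagonal, mul_comm] at h
  rw [hdet]
  exact mul_right_cancel₀ hdetV h

end Roots

/-! ### The shape of Blakestad–Grant's (4): the scaled kernel polynomial is integral and `≡ ℓ₀ (mod p)` -/

section KernelPolynomial

variable {F : Type*} [Field F]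

/-- `deg Φ_w ≤ n`. [folklore] -/
theorem natDegree_normForm_le (hg : g.Monic) (w : A[X]) : (normForm hg w).natDegree ≤ g.natDegree := by
  have h := Polynomial.natDegree_det_X_add_C_le (mulMatrix hg (AdjoinRoot.root g)) (-mulMatrix hg (AdjoinRoot.mk g w))
  rwa [Fintype.card_fin] at h

/-- **Blakestad–Grant (4) by norms.** Let `g ∈ A[q]` be monic of degree `n` with `g ≡ qⁿ (mod p)`
and `g(0) = p·c`, `c ∈ Aˣ` (a *distinguished* polynomial, e.g. the even Weierstrass factor `e⁺` of
`[p]`, `[p](s) = s·e⁺(s²)·unit`), and let `w ∈ A[q]` (e.g. `z²x(z) = ξ(z²)` reduced mod `e⁺`). Over a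
field `F ⊇ A` in which `g = ∏ⱼ(q - qⱼ)` with the `qⱼ` distinct, put `xⱼ = w(qⱼ)/qⱼ` (the
`x`-coordinates of the kernel) and `φ = (-1)ⁿc⁻¹·Φ_w ∈ A[X]`. Then **`φ = p·∏ⱼ(X - xⱼ)` in `F[X]`,
`deg φ ≤ n`, `[Xⁿ]φ = p`, `p ∣ [Xᵏ]φ` for `k ≥ 1`, and `[X⁰]φ ≡ c⁻¹·w(0)ⁿ (mod p)`** — "every
elementary symmetric function of the `xⱼ` lies in `A` except the product, which lies in `p⁻¹A`",
and `φ ≡ ℓ₀` a unit when `w(0)` is. [Blakestad–Grant 2023, Prop. 7 (a) (proof) and eq. (4)]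
[cite: BlakestadGrant2023, Prop. 7, eq. (4)] -/
theorem kernelPolynomial_of_distinguished (hg : g.Monic) {p c : A} (hc : IsUnit c) (hg0 : g.coeff 0 = p * c)
    (hgI : ∀ k < g.natDegree, g.coeff k ∈ Ideal.span {p}) (w : A[X]) (f : A →+* F) (hf : Function.Injective f)
    (hp : p ≠ 0) {q : Fin g.natDegree → F} (hq : Function.Injective q) (hsplit : g.map f = ∏ j, (X - C (q j))) :
    (C ((-1) ^ g.natDegree * (↑hc.unit⁻¹ : A)) * normForm hg w).map f =
        C (f p) * ∏ j, (X - C (w.eval₂ f (q j) / q j)) ∧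
      (C ((-1) ^ g.natDegree * (↑hc.unit⁻¹ : A)) * normForm hg w).natDegree ≤ g.natDegree ∧
      (C ((-1) ^ g.natDegree * (↑hc.unit⁻¹ : A)) * normForm hg w).coeff g.natDegree = p ∧
      (∀ k, 1 ≤ k → p ∣ (C ((-1) ^ g.natDegree * (↑hc.unit⁻¹ : A)) * normForm hg w).coeff k) ∧
      p ∣ (C ((-1) ^ g.natDegree * (↑hc.unit⁻¹ : A)) * normForm hg w).coeff 0 - (↑hc.unit⁻¹ : A) * w.coeff 0 ^ g.natDegree := by
  set ci : A := ↑hc.unit⁻¹ with hci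
  have hcci : c * ci = 1 := hc.mul_val_inv
  set Φ := normForm hg w with hΦ
  set φ := C ((-1) ^ g.natDegree * ci) * Φ with hφ
  -- roots: `g(qⱼ) = 0`, `qⱼ ≠ 0`, `∏ qⱼ = (-1)ⁿ f(pc)`
  have hroot : ∀ j, g.eval₂ f (q j) = 0 := by
    intro j
    rw [← Polynomial.eval_map, hsplit, Polynomial.eval_prod]
    exact Finset.prod_eq_zero (Finset.mem_univ j) (by rw [eval_sub, eval_X, eval_C, sub_self])
  have hprod : ∏ j, q j = (-1) ^ g.natDegree * f (p * c) := by
    have h := congrArg (fun P : F[X] => P.coeff 0) hsplit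
    simp only [Polynomial.coeff_map, coeff_zero_prod, coeff_sub, coeff_X_zero, coeff_C_zero, zero_sub,
      Finset.prod_neg, Finset.card_univ, Fintype.card_fin, hg0] at h
    rw [h, ← mul_assoc, ← mul_pow, neg_one_mul, neg_neg, one_pow, one_mul]
  have hq0 : ∀ j, q j ≠ 0 := by
    intro j hj
    have h0 : ∏ j, q j = 0 := Finset.prod_eq_zero (Finset.mem_univ j) hj
    rw [hprod, map_mul, mul_eq_zero, mul_eq_zero] at h0
    rcases h0 with h0 | h0 | h0
    · exact (pow_ne_zero _ (neg_ne_zero.mpr one_ne_zero)) h0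
    · exact hp (hf (by rw [h0, map_zero]))
    · exact (hc.map f).ne_zero h0
  -- (i) the factorisation over `F`
  have hfac : φ.map f = C (f p) * ∏ j, (X - C (w.eval₂ f (q j) / q j)) := by
    rw [hφ, Polynomial.map_mul, Polynomial.map_C, hΦ, normForm_map_eq_prod hg f hq hroot w]
    have e : ∀ j, C (q j) * X - C (w.eval₂ f (q j)) = C (q j) * (X - C (w.eval₂ f (q j) / q j)) := by
      intro j
      rw [mul_sub, ← map_mul, mul_div_cancel₀ _ (hq0 j)]
    simp only [e, Finset.prod_mul_distrib]
    rw [← mul_assoc, ← map_prod C, ← map_mul C, hprod]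
    congr 2
    simp only [map_mul, map_pow, map_neg, map_one]
    have hfc : f c * f ci = 1 := by rw [← map_mul, hcci, map_one]
    have hsq : ((-1 : F) ^ g.natDegree) * (-1) ^ g.natDegree = 1 := by rw [← mul_pow, neg_one_mul, neg_neg, one_pow]
    linear_combination (f p) * ((-1 : F) ^ g.natDegree * (-1) ^ g.natDegree) * hfc + (f p) * hsq
  -- (ii) degree
  have hdeg : φ.natDegree ≤ g.natDegree := by
    refine (natDegree_C_mul_le _ _).trans ?_
    exact natDegree_normForm_le hg w
  -- (iii) leading coefficient `p` (compare over `F`)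
  have hmonic : (∏ j : Fin g.natDegree, (X - C (w.eval₂ f (q j) / q j))).Monic :=
    monic_prod_of_monic _ _ fun j _ => monic_X_sub_C _
  have hdegprod : (∏ j : Fin g.natDegree, (X - C (w.eval₂ f (q j) / q j))).natDegree = g.natDegree := by
    rw [natDegree_prod_of_monic _ _ fun j _ => monic_X_sub_C _]
    simp
  have hlead : φ.coeff g.natDegree = p := by
    apply hf
    have h := congrArg (fun P : F[X] => P.coeff g.natDegree) hfac
    simp only [Polynomial.coeff_map, coeff_C_mul] at h
    have h1 := hmonic.coeff_natDegree
    rw [hdegprod] at h1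
    rw [h, h1, mul_one]
  -- (iv), (v) congruences mod `p`
  have hmod := normForm_map_mk hg hgI w
  have hcoeff : ∀ k, Ideal.Quotient.mk (Ideal.span {p}) (Φ.coeff k) =
      if k = 0 then Ideal.Quotient.mk (Ideal.span {p}) ((-w.coeff 0) ^ g.natDegree) else 0 := by
    intro k
    have h := congrArg (fun P => Polynomial.coeff P k) hmod
    simp only [Polynomial.coeff_map, coeff_C] at h
    exact h
  refine ⟨hfac, hdeg, hlead, ?_, ?_⟩
  · intro k hk
    have hk' := hcoeff k
    rw [if_neg (by omega), Ideal.Quotient.eq_zero_iff_mem] at hk'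
    rw [hφ, coeff_C_mul]
    exact Ideal.mem_span_singleton.mp (Ideal.mul_mem_left _ _ hk')
  · have hk := hcoeff 0
    rw [if_pos rfl] at hk
    have hm : Φ.coeff 0 - (-w.coeff 0) ^ g.natDegree ∈ Ideal.span {p} := Ideal.Quotient.eq.mp hk
    have e2 : ((-1 : A) ^ g.natDegree) ^ 2 = 1 := by rw [← pow_mul, mul_comm, pow_mul, neg_one_sq, one_pow]
    have e : (C ((-1) ^ g.natDegree * ci) * Φ).coeff 0 - ci * w.coeff 0 ^ g.natDegree =
        (-1) ^ g.natDegree * ci * (Φ.coeff 0 - (-w.coeff 0) ^ g.natDegree) := by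
      rw [coeff_C_mul, neg_pow]
      linear_combination (ci * w.coeff 0 ^ g.natDegree) * e2
    rw [hφ, e]
    exact Ideal.mem_span_singleton.mp (Ideal.mul_mem_left _ _ hm)

end KernelPolynomial

end Literature.NumberTheory.EllipticCurves.CanonicalSubgroupNorm
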